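import Summits.NavierStokesRegularity.NavierStokesRegularity.Theorems.TerminalTraceTypeITraceScarL3LateSweep
import HarnessLib

/-!
# TIME-SHIFT heredity of the extinct Type-I apex package, top-vanishing from a.e. vanishing, and the rate as a
# product-a.e. bound (tools for stub Z1 `stub_lateBoundedLiouville` of the candidate line `radius_dichotomy`, item
# `TerminalTrace.TypeITraceScarL3`, stmt-NavierStokesRegularity-18385)

Seat nsreg-C26-p1 g5 (cell ns-regularity-ideate), `--supports stmt-NavierStokesRegularity-18385` (helper).

* `apexPackage_timeShift` — the package passes to `(s, y) ↦ (U, P, G)(s₁ + s, y)` for every `s₁ ≤ 0` (`C ≥ 0`)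
  (word for word `apexPackage_translate` with the apex `(0, x)` replaced by `(s₁, 0)`);
* `weakNull_timeShift_of_ae_zero` — vanishing a.e. on `]s₁ − η, s₁[ × ℝ³` gives the weak null top at `s₁` (Fubini);
* `ae_prod_norm_le_of_rate` — the slice-wise rate is a product-a.e. bound `‖U‖ ≤ C/√b` on `]−T, −b[ × ℝ³`.
WHAT THIS IS NOT: 18385 / NS regularity NOT proved. [folklore; AlbrittonBarker2019 §3]
-/


noncomputable section

set_option linter.dupNamespace false

namespace Summit.NavierStokesRegularity.NavierStokesRegularity.Theorems.TypeITraceScarL3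

open MeasureTheory Set Function Filter Topology TopologicalSpace Metric InnerProductSpace
open Literature.Analysis.FluidPDE
open scoped NNReal ENNReal RealInnerProductSpace

section TimeShift

variable (s₁ : ℝ)

/-- The unit zoom about `(s₁, 0)` is the time shift (fields with values in a normed space). [folklore] -/
theorem one_smul_stPull_one_eq_timeShift {F : Type*} [NormedAddCommGroup F] [NormedSpace ℝ F]
    (ψ : ℝ → EuclideanSpace ℝ (Fin 3) → F) :
    (1 : ℝ) • stPull ((1 : ℝ) ^ 2) 1 s₁ (0 : EuclideanSpace ℝ (Fin 3)) ψ = fun s y => ψ (s₁ + s) y := by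
  funext s y
  simp [stPull]

/-- The same, `1² •` form. [folklore] -/
theorem one_sq_smul_stPull_one_eq_timeShift {F : Type*} [NormedAddCommGroup F] [NormedSpace ℝ F]
    (ψ : ℝ → EuclideanSpace ℝ (Fin 3) → F) :
    (1 : ℝ) ^ 2 • stPull ((1 : ℝ) ^ 2) 1 s₁ (0 : EuclideanSpace ℝ (Fin 3)) ψ = fun s y => ψ (s₁ + s) y := by
  funext s y
  simp [stPull]

/-- The same for gradient fields, `1² •` form. [folklore] -/
theorem one_sq_smul_stPull_one_eq_timeShift_grad
    (G : ℝ → EuclideanSpace ℝ (Fin 3) → EuclideanSpace ℝ (Fin 3) →L[ℝ] EuclideanSpace ℝ (Fin 3)) :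
    (1 : ℝ) ^ 2 • stPull ((1 : ℝ) ^ 2) 1 s₁ (0 : EuclideanSpace ℝ (Fin 3)) G = fun s y => G (s₁ + s) y := by
  funext s y
  simp [stPull]

/-- The same for gradient fields, `(1·1) •` form. [folklore] -/
theorem one_mul_one_smul_stPull_one_eq_timeShift_grad
    (G : ℝ → EuclideanSpace ℝ (Fin 3) → EuclideanSpace ℝ (Fin 3) →L[ℝ] EuclideanSpace ℝ (Fin 3)) :
    ((1 : ℝ) * 1) • stPull ((1 : ℝ) ^ 2) 1 s₁ (0 : EuclideanSpace ℝ (Fin 3)) G = fun s y => G (s₁ + s) y := by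
  funext s y
  simp [stPull]

/-- Zoom to the unit ball about `(s₁, 0)` followed by the zoom-out by `a⁻¹` about the origin is the time shift
(velocity weights). [folklore] -/
theorem zoomOut_zoom_eq_timeShift {F : Type*} [NormedAddCommGroup F] [NormedSpace ℝ F] {a : ℝ}
    (ha : a ≠ 0) (ψ : ℝ → EuclideanSpace ℝ (Fin 3) → F) :
    a⁻¹ • stPull (a⁻¹ ^ 2) a⁻¹ (0 : ℝ) (0 : EuclideanSpace ℝ (Fin 3))
        (a • stPull (a ^ 2) a s₁ (0 : EuclideanSpace ℝ (Fin 3)) ψ) = fun s y => ψ (s₁ + s) y := by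
  funext s y
  have h1 : s₁ + a ^ 2 * (0 + a⁻¹ ^ 2 * s) = s₁ + s := by
    rw [zero_add, ← mul_assoc, ← mul_pow, mul_inv_cancel₀ ha, one_pow, one_mul]
  have h2 : (0 : EuclideanSpace ℝ (Fin 3)) + a • ((0 : EuclideanSpace ℝ (Fin 3)) + a⁻¹ • y) = y := by
    rw [zero_add, zero_add, smul_smul, mul_inv_cancel₀ ha, one_smul]
  show a⁻¹ • (a • ψ (s₁ + a ^ 2 * (0 + a⁻¹ ^ 2 * s)) (0 + a • (0 + a⁻¹ • y))) = ψ (s₁ + s) y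
  rw [h1, h2, smul_smul, inv_mul_cancel₀ ha, one_smul]

/-- The same with the pressure weights `a²`, `a⁻²`. [folklore] -/
theorem zoomOut_zoom_eq_timeShift_sq {F : Type*} [NormedAddCommGroup F] [NormedSpace ℝ F] {a : ℝ}
    (ha : a ≠ 0) (ψ : ℝ → EuclideanSpace ℝ (Fin 3) → F) :
    a⁻¹ ^ 2 • stPull (a⁻¹ ^ 2) a⁻¹ (0 : ℝ) (0 : EuclideanSpace ℝ (Fin 3))
        (a ^ 2 • stPull (a ^ 2) a s₁ (0 : EuclideanSpace ℝ (Fin 3)) ψ) = fun s y => ψ (s₁ + s) y := by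
  funext s y
  have h1 : s₁ + a ^ 2 * (0 + a⁻¹ ^ 2 * s) = s₁ + s := by
    rw [zero_add, ← mul_assoc, ← mul_pow, mul_inv_cancel₀ ha, one_pow, one_mul]
  have h2 : (0 : EuclideanSpace ℝ (Fin 3)) + a • ((0 : EuclideanSpace ℝ (Fin 3)) + a⁻¹ • y) = y := by
    rw [zero_add, zero_add, smul_smul, mul_inv_cancel₀ ha, one_smul]
  have h3 : a⁻¹ ^ 2 * a ^ 2 = 1 := by rw [← mul_pow, inv_mul_cancel₀ ha, one_pow]
  show a⁻¹ ^ 2 • (a ^ 2 • ψ (s₁ + a ^ 2 * (0 + a⁻¹ ^ 2 * s)) (0 + a • (0 + a⁻¹ • y))) = ψ (s₁ + s) y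
  rw [h1, h2, smul_smul, h3, one_smul]

/-- The unit affine map about `(s₁, 0)` sends the origin to `(s₁, 0)`. [folklore] -/
theorem stAffine_one_timeShift_apply_zero :
    stAffine ((1 : ℝ) ^ 2) 1 s₁ (0 : EuclideanSpace ℝ (Fin 3)) (0 : ℝ × EuclideanSpace ℝ (Fin 3)) =
      ((s₁ : ℝ), (0 : EuclideanSpace ℝ (Fin 3))) := by
  simp [stAffine]

/-- The time shift pulls `Q_r((s₁, 0))` back to `Q_r(0)`. [folklore] -/
theorem stAffine_one_timeShift_preimage_parabolicCylinder (r : ℝ) :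
    stAffine ((1 : ℝ) ^ 2) 1 s₁ (0 : EuclideanSpace ℝ (Fin 3)) ⁻¹'
        parabolicCylinder r (((s₁ : ℝ), (0 : EuclideanSpace ℝ (Fin 3))) : ℝ × EuclideanSpace ℝ (Fin 3)) =
      parabolicCylinder r (0 : ℝ × EuclideanSpace ℝ (Fin 3)) := by
  have key := LocalTypeIScaling.stAffine_preimage_parabolicCylinder one_pos s₁ (0 : EuclideanSpace ℝ (Fin 3)) r
    (0 : ℝ × EuclideanSpace ℝ (Fin 3))
  rwa [one_mul, stAffine_one_timeShift_apply_zero] at key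

variable {s₁}

/-- `Q_a((s₁, 0)) ⊆ Q_{a + |s₁| + 1}(0)` for `a > 0`, `s₁ ≤ 0`. [folklore] -/
theorem parabolicCylinder_timeShift_subset_zero (hs₁ : s₁ ≤ 0) {a : ℝ} (ha : 0 < a) :
    parabolicCylinder a (((s₁ : ℝ), (0 : EuclideanSpace ℝ (Fin 3))) : ℝ × EuclideanSpace ℝ (Fin 3)) ⊆
      parabolicCylinder (a + |s₁| + 1) (0 : ℝ × EuclideanSpace ℝ (Fin 3)) := by
  rintro ⟨s, y⟩ hw
  rw [mem_parabolicCylinder] at hw ⊢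
  obtain ⟨⟨hs1, hs2⟩, hy⟩ := hw
  have h1 : |s₁| = -s₁ := abs_of_nonpos hs₁
  have ha0 : 0 ≤ |s₁| := abs_nonneg s₁
  dsimp only at hs1 hs2 hy
  simp only [Prod.fst_zero, Prod.snd_zero, zero_sub]
  have hy' : dist y (0 : EuclideanSpace ℝ (Fin 3)) < a := hy
  have hsq : a ^ 2 + |s₁| ≤ (a + |s₁| + 1) ^ 2 := by nlinarith
  refine ⟨⟨by linarith, by linarith⟩, by linarith⟩

/-- **HEREDITY of the apex package under a TIME SHIFT to an earlier apex** `s₁ ≤ 0`: if `(U, P, G)` carries the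
extinct Type-I apex package of class `(M, D₀, C)` at the origin (without the top-vanishing clause) and `C ≥ 0`, then
`(s, y) ↦ (U, P, G)(s₁ + s, y)` carries it too, with the same class: suitable in every `Q(a)` (restrict to
`Q_a((s₁,0)) ⊆ Q_{a+|s₁|+1}(0)`, zoom, zoom out), weak gradient and `𝐈 ≤ M` (scaling covariance), `D ≤ D₀` (apices
`≤ 0` shift to apices `≤ 0`), rate `C/√(−s) ≥ C/√(−s − s₁)`.
[cite: AlbrittonBarker2019, §3 ("by translating in space-time and rescaling")] -/
theorem apexPackage_timeShift
    {U : ℝ → EuclideanSpace ℝ (Fin 3) → EuclideanSpace ℝ (Fin 3)}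
    {P : ℝ → EuclideanSpace ℝ (Fin 3) → ℝ}
    {G : ℝ → EuclideanSpace ℝ (Fin 3) → EuclideanSpace ℝ (Fin 3) →L[ℝ] EuclideanSpace ℝ (Fin 3)}
    {M D₀ : ℝ≥0} {C : ℝ}
    (hsw : ∀ a : ℝ, 0 < a →
      IsSuitableWeakSolutionInBall a (0 : ℝ × EuclideanSpace ℝ (Fin 3)) U P)
    (hG : ∀ a : ℝ, 0 < a →
      HasWeakSpatialGradientOn
        (parabolicCylinderOpens a (0 : ℝ × EuclideanSpace ℝ (Fin 3))) U G)
    (hI : ∀ a : ℝ, 0 < a →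
      typeIBound (parabolicCylinder a (0 : ℝ × EuclideanSpace ℝ (Fin 3))) U P G ≤ M)
    (hD : ∀ z₀ : ℝ × EuclideanSpace ℝ (Fin 3), z₀.1 ≤ 0 →
      ∀ r : ℝ, 0 < r → cknD r z₀ P ≤ D₀)
    (hrate : ∀ s : ℝ, s < 0 →
      ∀ᵐ y : EuclideanSpace ℝ (Fin 3), ‖U s y‖ ≤ C / Real.sqrt (-s))
    (hs₁ : s₁ ≤ 0) (hC : 0 ≤ C) :
    (∀ a : ℝ, 0 < a →
      IsSuitableWeakSolutionInBall a (0 : ℝ × EuclideanSpace ℝ (Fin 3))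
        (fun s y => U (s₁ + s) y) (fun s y => P (s₁ + s) y)) ∧
    (∀ a : ℝ, 0 < a →
      HasWeakSpatialGradientOn
        (parabolicCylinderOpens a (0 : ℝ × EuclideanSpace ℝ (Fin 3)))
        (fun s y => U (s₁ + s) y) (fun s y => G (s₁ + s) y)) ∧
    (∀ a : ℝ, 0 < a →
      typeIBound (parabolicCylinder a (0 : ℝ × EuclideanSpace ℝ (Fin 3)))
        (fun s y => U (s₁ + s) y) (fun s y => P (s₁ + s) y) (fun s y => G (s₁ + s) y) ≤ M) ∧
    (∀ z₀ : ℝ × EuclideanSpace ℝ (Fin 3), z₀.1 ≤ 0 →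
      ∀ r : ℝ, 0 < r → cknD r z₀ (fun s y => P (s₁ + s) y) ≤ D₀) ∧
    (∀ s : ℝ, s < 0 →
      ∀ᵐ y : EuclideanSpace ℝ (Fin 3), ‖(fun s y => U (s₁ + s) y) s y‖ ≤ C / Real.sqrt (-s)) := by
  refine ⟨fun a ha => ?_, fun a ha => ?_, fun a ha => ?_, fun z₀ hz₀ r hr => ?_, fun s hs => ?_⟩
  · -- suitable in every `Q(a)`
    have ha' : 0 < a + |s₁| + 1 := by positivity
    have h1 : IsSuitableWeakSolutionInBall a (((s₁ : ℝ), (0 : EuclideanSpace ℝ (Fin 3))) :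
        ℝ × EuclideanSpace ℝ (Fin 3)) U P :=
      (hsw _ ha').of_subset_zero ha (parabolicCylinder_timeShift_subset_zero hs₁ ha)
    have h2 := (h1.zoom ha).zoomOut (c := a⁻¹) (inv_pos.2 ha)
    dsimp only at h2
    rw [zoomOut_zoom_eq_timeShift s₁ ha.ne', zoomOut_zoom_eq_timeShift_sq s₁ ha.ne', one_div, inv_inv] at h2
    exact h2
  · -- weak gradient
    have ha' : 0 < a + |s₁| + 1 := by positivity
    have hle : parabolicCylinderOpens a (((s₁ : ℝ), (0 : EuclideanSpace ℝ (Fin 3))) :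
        ℝ × EuclideanSpace ℝ (Fin 3)) ≤
        parabolicCylinderOpens (a + |s₁| + 1) (0 : ℝ × EuclideanSpace ℝ (Fin 3)) :=
      fun w hw => parabolicCylinder_timeShift_subset_zero hs₁ ha hw
    have h1 := ((hG _ ha').mono hle).stRescale 1 (β := (1 : ℝ) ^ 2) (γ := 1) (by norm_num) one_pos s₁
      (0 : EuclideanSpace ℝ (Fin 3))
    have hpre : stPreimage ((1 : ℝ) ^ 2) 1 s₁ (0 : EuclideanSpace ℝ (Fin 3))
        (parabolicCylinderOpens a (((s₁ : ℝ), (0 : EuclideanSpace ℝ (Fin 3))) :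
          ℝ × EuclideanSpace ℝ (Fin 3))) =
        parabolicCylinderOpens a (0 : ℝ × EuclideanSpace ℝ (Fin 3)) :=
      TopologicalSpace.Opens.ext (stAffine_one_timeShift_preimage_parabolicCylinder s₁ a)
    rw [hpre, one_smul_stPull_one_eq_timeShift, one_mul_one_smul_stPull_one_eq_timeShift_grad] at h1
    exact h1
  · -- `𝐈 ≤ M`
    have ha' : 0 < a + |s₁| + 1 := by positivity
    have key := typeIBound_nsZoom one_pos s₁ (0 : EuclideanSpace ℝ (Fin 3))
      (parabolicCylinder a (((s₁ : ℝ), (0 : EuclideanSpace ℝ (Fin 3))) : ℝ × EuclideanSpace ℝ (Fin 3))) U P G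
    rw [stAffine_one_timeShift_preimage_parabolicCylinder, one_smul_stPull_one_eq_timeShift,
      one_sq_smul_stPull_one_eq_timeShift, one_sq_smul_stPull_one_eq_timeShift_grad] at key
    rw [key]
    exact (typeIBound_mono (parabolicCylinder_timeShift_subset_zero hs₁ ha)).trans (hI _ ha')
  · -- `D ≤ D₀`
    have key := cknD_nsZoom one_pos hr s₁ (0 : EuclideanSpace ℝ (Fin 3)) z₀ P
    rw [one_sq_smul_stPull_one_eq_timeShift, one_mul] at key
    rw [key]
    refine hD _ ?_ r hr
    simp only [stAffine, one_pow, one_mul]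
    linarith
  · -- the rate
    have hs' : s₁ + s < 0 := by linarith
    filter_upwards [hrate (s₁ + s) hs'] with y hy
    have hpos : 0 < Real.sqrt (-s) := Real.sqrt_pos.2 (by linarith)
    have hle : Real.sqrt (-s) ≤ Real.sqrt (-(s₁ + s)) := Real.sqrt_le_sqrt (by linarith)
    calc ‖U (s₁ + s) y‖ ≤ C / Real.sqrt (-(s₁ + s)) := hy
      _ ≤ C / Real.sqrt (-s) := div_le_div_of_nonneg_left hC hpos hle

end TimeShift

/-! ### Top-vanishing from a.e. vanishing on a left neighbourhood of the apex -/

/-- If `U = 0` a.e. on the whole-space slab `]−η, 0[ × ℝ³` (`η > 0`), then `U` is weakly null at the top time (Fubini: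
for a.e. `s ∈ ]−η, 0[` the slice vanishes a.e., so every pairing vanishes). [folklore] -/
theorem weakNull_of_ae_zero_slab
    {U : ℝ → EuclideanSpace ℝ (Fin 3) → EuclideanSpace ℝ (Fin 3)} {η : ℝ} (hη : 0 < η)
    (h0 : ∀ᵐ z ∂(volume.restrict (Ioo (-η) 0 ×ˢ (univ : Set (EuclideanSpace ℝ (Fin 3))))), U z.1 z.2 = 0) :
    ∀ φ : EuclideanSpace ℝ (Fin 3) → EuclideanSpace ℝ (Fin 3),
      ContDiff ℝ (⊤ : ℕ∞) φ →
      HasCompactSupport φ → ∀ ε : ℝ, 0 < ε →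
      ∃ s₀ : ℝ, s₀ < 0 ∧ ∀ᵐ s ∂(volume.restrict (Ioo s₀ 0)), |∫ y, ⟪U s y, φ y⟫| ≤ ε := by
  intro φ _ _ ε hε
  refine ⟨-η, by linarith, ?_⟩
  have h1 : ∀ᵐ z ∂((volume.restrict (Ioo (-η) (0 : ℝ))).prod
      ((volume : Measure (EuclideanSpace ℝ (Fin 3))).restrict univ)), U z.1 z.2 = 0 := by
    rw [Measure.prod_restrict, ← Measure.volume_eq_prod]
    exact h0
  have h2 := Measure.ae_ae_of_ae_prod h1
  filter_upwards [h2] with s hs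
  rw [Measure.restrict_univ] at hs
  have hint : (∫ y, ⟪U s y, φ y⟫) = 0 := by
    rw [← integral_zero (α := EuclideanSpace ℝ (Fin 3)) (G := ℝ)]
    refine integral_congr_ae ?_
    filter_upwards [hs] with y hy
    simp [hy]
  rw [hint, abs_zero]
  exact hε.le

/-- The same for the TIME-SHIFTED field at an apex `s₁`: if `U = 0` a.e. on `]s₁ − η, s₁[ × ℝ³` (`η > 0`), then
`(s, y) ↦ U(s₁ + s, y)` is weakly null at the top time. [folklore] -/
theorem weakNull_timeShift_of_ae_zero
    {U : ℝ → EuclideanSpace ℝ (Fin 3) → EuclideanSpace ℝ (Fin 3)} {s₁ η : ℝ} (hη : 0 < η)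
    (h0 : ∀ᵐ z ∂(volume.restrict (Ioo (s₁ - η) s₁ ×ˢ (univ : Set (EuclideanSpace ℝ (Fin 3))))), U z.1 z.2 = 0) :
    ∀ φ : EuclideanSpace ℝ (Fin 3) → EuclideanSpace ℝ (Fin 3),
      ContDiff ℝ (⊤ : ℕ∞) φ →
      HasCompactSupport φ → ∀ ε : ℝ, 0 < ε →
      ∃ s₀ : ℝ, s₀ < 0 ∧ ∀ᵐ s ∂(volume.restrict (Ioo s₀ 0)),
        |∫ y, ⟪(fun s y => U (s₁ + s) y) s y, φ y⟫| ≤ ε := by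
  refine weakNull_of_ae_zero_slab hη ?_
  -- transport along the time translation `(s, y) ↦ (s₁ + s, y)`, a measure-preserving map
  set T : ℝ × EuclideanSpace ℝ (Fin 3) → ℝ × EuclideanSpace ℝ (Fin 3) := fun z => (s₁ + z.1, z.2) with hT
  have hTm : Measurable T := (measurable_const.add measurable_fst).prodMk measurable_snd
  have hmp : MeasurePreserving T (volume : Measure (ℝ × EuclideanSpace ℝ (Fin 3)))
      (volume : Measure (ℝ × EuclideanSpace ℝ (Fin 3))) :=
    (measurePreserving_add_left (volume : Measure ℝ) s₁).prod
      (MeasurePreserving.id (volume : Measure (EuclideanSpace ℝ (Fin 3))))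
  have hA : MeasurableSet (Ioo (s₁ - η) s₁ ×ˢ (univ : Set (EuclideanSpace ℝ (Fin 3)))) :=
    measurableSet_Ioo.prod MeasurableSet.univ
  have h' : ∀ᵐ z ∂(volume : Measure (ℝ × EuclideanSpace ℝ (Fin 3))),
      z ∈ Ioo (s₁ - η) s₁ ×ˢ (univ : Set (EuclideanSpace ℝ (Fin 3))) → U z.1 z.2 = 0 :=
    (ae_restrict_iff' hA).1 h0
  have h'' := hmp.quasiMeasurePreserving.ae h'
  rw [ae_restrict_iff' (measurableSet_Ioo.prod MeasurableSet.univ)]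
  filter_upwards [h''] with z hz hzmem
  refine hz ⟨⟨?_, ?_⟩, mem_univ _⟩
  · show s₁ - η < s₁ + z.1
    linarith [hzmem.1.1]
  · show s₁ + z.1 < s₁
    linarith [hzmem.1.2]

/-! ### From the rate on slices to a product-a.e. bound -/

/-- If `uncurry U` is a.e. strongly measurable on `S × ℝ³` (`S` measurable) and every slice `U(s, ·)`, `s ∈ S`, is a.e.
bounded by `L`, then `‖U‖ ≤ L` a.e. on `S × ℝ³` for the product Lebesgue measure (Fubini through a strongly measurable
representative). [folklore] -/
theorem ae_prod_norm_le_of_slices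
    {U : ℝ → EuclideanSpace ℝ (Fin 3) → EuclideanSpace ℝ (Fin 3)} {S : Set ℝ} (hS : MeasurableSet S)
    (hU : AEStronglyMeasurable (uncurry U)
      (volume.restrict (S ×ˢ (univ : Set (EuclideanSpace ℝ (Fin 3))))))
    {L : ℝ} (h : ∀ s ∈ S, ∀ᵐ y : EuclideanSpace ℝ (Fin 3), ‖U s y‖ ≤ L) :
    ∀ᵐ z ∂(volume.restrict (S ×ˢ (univ : Set (EuclideanSpace ℝ (Fin 3))))), ‖U z.1 z.2‖ ≤ L := by
  obtain ⟨V, hVm, hUV⟩ := hU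
  have hprod : (volume.restrict (S ×ˢ (univ : Set (EuclideanSpace ℝ (Fin 3))))) =
      ((volume : Measure ℝ).restrict S).prod
        ((volume : Measure (EuclideanSpace ℝ (Fin 3))).restrict univ) := by
    rw [Measure.prod_restrict, ← Measure.volume_eq_prod]
  have hE : MeasurableSet {z : ℝ × EuclideanSpace ℝ (Fin 3) | ‖V z‖ ≤ L} :=
    measurableSet_le hVm.norm.measurable measurable_const
  -- slices of the representative
  have h1 : ∀ᵐ s ∂((volume : Measure ℝ).restrict S), ∀ᵐ y ∂((volume : Measure (EuclideanSpace ℝ (Fin 3))).restrict univ),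
      uncurry U (s, y) = V (s, y) := by
    have := hUV
    rw [hprod] at this
    exact Measure.ae_ae_of_ae_prod this
  have h2 : ∀ᵐ s ∂((volume : Measure ℝ).restrict S), ∀ᵐ y ∂((volume : Measure (EuclideanSpace ℝ (Fin 3))).restrict univ),
      (s, y) ∈ {z : ℝ × EuclideanSpace ℝ (Fin 3) | ‖V z‖ ≤ L} := by
    filter_upwards [h1, ae_restrict_mem hS] with s hs hsS
    have h3 : ∀ᵐ y : EuclideanSpace ℝ (Fin 3), ‖U s y‖ ≤ L := h s hsS
    rw [Measure.restrict_univ] at hs ⊢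
    filter_upwards [hs, h3] with y hy hy'
    show ‖V (s, y)‖ ≤ L
    rw [← hy]
    exact hy'
  have h4 : ∀ᵐ z ∂(volume.restrict (S ×ˢ (univ : Set (EuclideanSpace ℝ (Fin 3))))),
      z ∈ {z : ℝ × EuclideanSpace ℝ (Fin 3) | ‖V z‖ ≤ L} := by
    rw [hprod]
    exact (Measure.ae_prod_mem_iff_ae_ae_mem hE).2 h2
  filter_upwards [h4, hUV] with z hz hzV
  have : ‖uncurry U z‖ ≤ L := by rw [hzV]; exact hz
  exact this

/-- **The rate gives a product-a.e. bound away from the top**: under the apex package, for `0 < b` and `b < T`,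
`‖U‖ ≤ C/√b` a.e. on `]−T, −b[ × ℝ³`. [folklore] -/
theorem ae_prod_norm_le_of_rate
    {U : ℝ → EuclideanSpace ℝ (Fin 3) → EuclideanSpace ℝ (Fin 3)}
    {P : ℝ → EuclideanSpace ℝ (Fin 3) → ℝ}
    (hsw : ∀ a : ℝ, 0 < a →
      IsSuitableWeakSolutionInBall a (0 : ℝ × EuclideanSpace ℝ (Fin 3)) U P)
    {C : ℝ} (hrate : ∀ s : ℝ, s < 0 →
      ∀ᵐ y : EuclideanSpace ℝ (Fin 3), ‖U s y‖ ≤ C / Real.sqrt (-s))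
    (hC : 0 ≤ C) {b T : ℝ} (hb : 0 < b) (hbT : b < T) :
    ∀ᵐ z ∂(volume.restrict (Ioo (-T) (-b) ×ˢ (univ : Set (EuclideanSpace ℝ (Fin 3))))),
      ‖U z.1 z.2‖ ≤ C / Real.sqrt b := by
  -- exhaust `ℝ³` by the balls `B(0, n)`, `n² ≥ T`
  obtain ⟨N, hN⟩ := exists_nat_ge (Real.sqrt T + 1)
  have hcov : Ioo (-T) (-b) ×ˢ (univ : Set (EuclideanSpace ℝ (Fin 3))) ⊆
      ⋃ n : ℕ, Ioo (-T) (-b) ×ˢ ball (0 : EuclideanSpace ℝ (Fin 3)) ((n : ℝ) + N) := by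
    rintro ⟨s, y⟩ ⟨hs, -⟩
    obtain ⟨n, hn⟩ := exists_nat_gt ‖y‖
    refine mem_iUnion.2 ⟨n, hs, ?_⟩
    rw [mem_ball, dist_zero_right]
    have : (0 : ℝ) ≤ N := Nat.cast_nonneg N
    linarith
  refine ae_restrict_of_ae_restrict_of_subset hcov ?_
  rw [ae_restrict_iUnion_iff]
  intro n
  have hn0 : (0 : ℝ) < (n : ℝ) + N := by
    have h1 : (0 : ℝ) ≤ n := Nat.cast_nonneg n
    have h2 : Real.sqrt T + 1 ≤ N := hN
    linarith [Real.sqrt_nonneg T]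
  -- the slab piece lies in `Q_{n+N}(0)` as soon as `(n+N)² ≥ T`
  have hT0 : 0 < T := hb.trans hbT
  have hsq : T ≤ ((n : ℝ) + N) ^ 2 := by
    have h1 : Real.sqrt T ≤ (n : ℝ) + N := by
      have : (0 : ℝ) ≤ n := Nat.cast_nonneg n
      linarith
    have h2 := pow_le_pow_left₀ (Real.sqrt_nonneg T) h1 2
    rwa [Real.sq_sqrt hT0.le] at h2
  have hsub : Ioo (-T) (-b) ×ˢ ball (0 : EuclideanSpace ℝ (Fin 3)) ((n : ℝ) + N) ⊆
      parabolicCylinder ((n : ℝ) + N) (0 : ℝ × EuclideanSpace ℝ (Fin 3)) := by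
    rintro ⟨s, y⟩ ⟨hs, hy⟩
    rw [mem_parabolicCylinder]
    exact ⟨⟨by simp only [Prod.fst_zero, zero_sub]; linarith [hs.1], by simpa using by linarith [hs.2]⟩,
      by simpa using hy⟩
  have hmeas : AEStronglyMeasurable (uncurry U)
      (volume.restrict (Ioo (-T) (-b) ×ˢ ball (0 : EuclideanSpace ℝ (Fin 3)) ((n : ℝ) + N))) := by
    have h := (hsw _ hn0).1.distributional.1.aestronglyMeasurable
    rw [coe_parabolicCylinderOpens] at h
    exact h.mono_measure (Measure.restrict_mono hsub le_rfl)
  -- slices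
  have hslice : ∀ s ∈ Ioo (-T) (-b), ∀ᵐ y : EuclideanSpace ℝ (Fin 3), ‖U s y‖ ≤ C / Real.sqrt b := by
    intro s hs
    have hs0 : s < 0 := by linarith [hs.2]
    filter_upwards [hrate s hs0] with y hy
    have hle : Real.sqrt b ≤ Real.sqrt (-s) := Real.sqrt_le_sqrt (by linarith [hs.2])
    exact hy.trans (div_le_div_of_nonneg_left hC (Real.sqrt_pos.2 hb) hle)
  -- product statement on `Ioo × ball` from the one on `Ioo × univ` restricted
  have hS : MeasurableSet (Ioo (-T) (-b)) := measurableSet_Ioo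
  -- representative on `Ioo × ball`, extended by Fubini
  obtain ⟨V, hVm, hUV⟩ := hmeas
  have hprod : (volume.restrict (Ioo (-T) (-b) ×ˢ ball (0 : EuclideanSpace ℝ (Fin 3)) ((n : ℝ) + N))) =
      ((volume : Measure ℝ).restrict (Ioo (-T) (-b))).prod
        ((volume : Measure (EuclideanSpace ℝ (Fin 3))).restrict (ball 0 ((n : ℝ) + N))) := by
    rw [Measure.prod_restrict, ← Measure.volume_eq_prod]
  have hE : MeasurableSet {z : ℝ × EuclideanSpace ℝ (Fin 3) | ‖V z‖ ≤ C / Real.sqrt b} :=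
    measurableSet_le hVm.norm.measurable measurable_const
  have h1 : ∀ᵐ s ∂((volume : Measure ℝ).restrict (Ioo (-T) (-b))),
      ∀ᵐ y ∂((volume : Measure (EuclideanSpace ℝ (Fin 3))).restrict (ball 0 ((n : ℝ) + N))),
        uncurry U (s, y) = V (s, y) := by
    have := hUV
    rw [hprod] at this
    exact Measure.ae_ae_of_ae_prod this
  have h2 : ∀ᵐ s ∂((volume : Measure ℝ).restrict (Ioo (-T) (-b))),
      ∀ᵐ y ∂((volume : Measure (EuclideanSpace ℝ (Fin 3))).restrict (ball 0 ((n : ℝ) + N))),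
        (s, y) ∈ {z : ℝ × EuclideanSpace ℝ (Fin 3) | ‖V z‖ ≤ C / Real.sqrt b} := by
    filter_upwards [h1, ae_restrict_mem hS] with s hs hsS
    filter_upwards [hs, ae_restrict_of_ae (hslice s hsS)] with y hy hy'
    show ‖V (s, y)‖ ≤ C / Real.sqrt b
    rw [← hy]
    exact hy'
  have h4 : ∀ᵐ z ∂(volume.restrict (Ioo (-T) (-b) ×ˢ ball (0 : EuclideanSpace ℝ (Fin 3)) ((n : ℝ) + N))),
      z ∈ {z : ℝ × EuclideanSpace ℝ (Fin 3) | ‖V z‖ ≤ C / Real.sqrt b} := by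
    rw [hprod]
    exact (Measure.ae_prod_mem_iff_ae_ae_mem hE).2 h2
  filter_upwards [h4, hUV] with z hz hzV
  have : ‖uncurry U z‖ ≤ C / Real.sqrt b := by rw [hzV]; exact hz
  exact this

end Summit.NavierStokesRegularity.NavierStokesRegularity.Theorems.TypeITraceScarL3

end
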